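import Mathlib.FieldTheory.Perfect
import Mathlib.FieldTheory.PurelyInseparable.Exponent
import Mathlib.RingTheory.RingHom.Smooth
import Mathlib.RingTheory.Valuation.ValuationSubring
import HarnessLib

/-!
# Frobenius descent of a smooth chart along a finite purely inseparable extension
# (crux `IndSmooth.ValuativeSmoothing`, line `birth` r2, stub `stub_frobeniusDescent`)

Stub `stub_frobeniusDescent` of the skeleton `Lines/birth.lean` (lead reshape r2) for crux
stmt-ResolutionOfSingularities-16087. Setting: `k` a perfect field of characteristic `p`,
`K/k` a field extension, `O` a valuation subring of `K`, `R` a `k`-subalgebra of `K`; a *Temkin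
chart* is a finite purely inseparable extension `L/K`, the valuation ring `O'` of `L` lying over
`O` (`O' ∩ K = O`) and a smooth `k`-subalgebra `N ⊆ O'` of `L` containing the image of `R`.

Claim: there are `n : ℕ` and a SMOOTH `k`-subalgebra `T ⊆ O` of `K` with `r ^ p ^ n ∈ T` for all
`r ∈ R`.

Proof. `L/K` finite purely inseparable has an exponent `n` (`x ^ p ^ n ∈ K` for all `x ∈ L`,
Mathlib `IsPurelyInseparable.hasExponent_of_finiteDimensional`), and the `pⁿ`-power map read in
`K` is a ring homomorphism `θ₀ : L →+* K` (`IsPurelyInseparable.iterateFrobenius`). Put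
`T := θ₀(N)`. Then
* `T ⊆ O`: `θ₀ x ∈ K` has image `x ^ p ^ n ∈ O'` in `L`, and `O' ∩ K = O`;
* `T ⊇ k`: `k` is perfect, so `c = (Frobⁿ)⁻¹(c) ^ p ^ n = θ₀((Frobⁿ)⁻¹ c)` for `c ∈ k`;
* `r ^ p ^ n = θ₀(r) ∈ T` for `r ∈ R ⊆ N`;
* `T` is smooth over `k`: `θ₀` restricts to a ring isomorphism `e : N ≃ T`, and as ring
  homomorphisms `algebraMap k T = e ∘ algebraMap k N ∘ (Frobⁿ)⁻¹`; smoothness of ring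
  homomorphisms is stable under composition and holds for bijections
  (`RingHom.Smooth.comp`, `RingHom.Smooth.of_bijective`, `RingHom.smooth_algebraMap`).
-/

-- single-problem summit: the doubled namespace component is forced
set_option linter.dupNamespace false

namespace Summit.ResolutionOfSingularities.ResolutionOfSingularities.Theorems.ValuativeSmoothing

/-- **Twisting the structure map by smooth bijections preserves smoothness.** If `N` is a smooth
`k`-algebra, `σ : k ≃+* k` is a ring automorphism, `e : N ≃+* T` is a ring isomorphism onto a
`k`-algebra `T`, and the structure map of `T` factors as `algebraMap k T = e ∘ algebraMap k N ∘ σ`,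
then `T` is a smooth `k`-algebra. [folklore] -/
theorem smooth_of_ringEquiv_twist {k N T : Type*} [CommRing k] [CommRing N] [CommRing T]
    [Algebra k N] [Algebra k T] (hN : Algebra.Smooth k N) (σ : k ≃+* k) (e : N ≃+* T)
    (h : algebraMap k T = e.toRingHom.comp ((algebraMap k N).comp σ.toRingHom)) :
    Algebra.Smooth k T := by
  have h1 : σ.toRingHom.Smooth := RingHom.Smooth.of_bijective σ.bijective
  have h2 : (algebraMap k N).Smooth := RingHom.smooth_algebraMap.mpr hN
  have h3 : e.toRingHom.Smooth := RingHom.Smooth.of_bijective e.bijective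
  have h123 := (h1.comp h2).comp h3
  rw [← h] at h123
  exact RingHom.smooth_algebraMap.mp h123

/-- **Stub `stub_frobeniusDescent` (line `birth` r2, crux `IndSmooth.ValuativeSmoothing`).**
Frobenius descent of a Temkin chart (`k` perfect of characteristic `p`): given a finite purely
inseparable extension `L/K`, the valuation ring `O'` of `L` over the valuation ring `O` of `K`
(`O'.comap (algebraMap K L) = O`) and a smooth `k`-subalgebra `N ⊆ O'` of `L` containing the image
of the `k`-subalgebra `R` of `K`, there are `n : ℕ` and a smooth `k`-subalgebra `T ⊆ O` of `K`
containing `r ^ p ^ n` for every `r ∈ R`: namely `n` = the exponent of `L/K` and `T` = the image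
of `N` under the `pⁿ`-power map `L → K`, which is a ring isomorphism `N ≅ T` twisting the
`k`-structure by the automorphism `Frobⁿ` of the perfect field `k`. [folklore] -/
theorem stub_frobeniusDescent (p : ℕ) (hp : p.Prime)
    (k K : Type) [Field k] [CharP k p] [PerfectField k] [Field K] [Algebra k K]
    (O : ValuationSubring K) (R : Subalgebra k K)
    (hchart :∃ (L : Type) (_ : Field L) (_ : Algebra K L) (_ : Algebra k L)
      (_ : IsScalarTower k K L),
      FiniteDimensional K L ∧ IsPurelyInseparable K L ∧
      ∃ O' : ValuationSubring L, O'.comap (algebraMap K L) = O ∧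
      ∃ N : Subalgebra k L, N.toSubring ≤ O'.toSubring ∧ N.FG ∧ Algebra.Smooth k N ∧
        ∀ r : K, r ∈ R → algebraMap K L r ∈ N) :
    ∃ (n : ℕ) (T : Subalgebra k K), T.toSubring ≤ O.toSubring ∧ Algebra.Smooth k T ∧
      ∀ r : K, r ∈ R → r ^ p ^ n ∈ T := by
  obtain ⟨L, _instF, _instA, _instA', _instT, hfd, hpi, O', rfl, N, hNO', -, hNs, hRN⟩ := hchart
  -- characteristic bookkeeping: `k`, `K` have (exponential) characteristic `p`
  haveI : ExpChar k p := ExpChar.prime hp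
  haveI : CharP K p := charP_of_injective_algebraMap (algebraMap k K).injective p
  haveI : ExpChar K p := ExpChar.prime hp
  haveI : FiniteDimensional K L := hfd
  haveI : IsPurelyInseparable K L := hpi
  -- the exponent `n` of `L/K` and the `pⁿ`-power map `θ₀ : L →+* K`
  obtain ⟨n, θ₀, hθ₀⟩ : ∃ (n : ℕ) (θ₀ : L →+* K), ∀ a : L, algebraMap K L (θ₀ a) = a ^ p ^ n :=
    ⟨IsPurelyInseparable.exponent K L, IsPurelyInseparable.iterateFrobenius K L p le_rfl,
      IsPurelyInseparable.algebraMap_iterateFrobenius K p le_rfl⟩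
  -- its restriction `θ : N →+* K`
  obtain ⟨θ, hθ, hθinj⟩ : ∃ θ : N →+* K,
      (∀ x : N, algebraMap K L (θ x) = (x : L) ^ p ^ n) ∧ Function.Injective θ :=
    ⟨θ₀.comp (N.val : N →+* L), fun x => hθ₀ x, θ₀.injective.comp Subtype.val_injective⟩
  -- the iterated Frobenius automorphism `σ = Frobⁿ` of the perfect field `k`
  obtain ⟨σ, hσ⟩ : ∃ σ : k ≃+* k, ∀ c : k, σ c = c ^ p ^ n :=
    ⟨iterateFrobeniusEquiv k p n, iterateFrobeniusEquiv_def k p n⟩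
  -- `θ (σ⁻¹ c) = c` for `c ∈ k`
  have hθσ : ∀ c : k, θ (algebraMap k N (σ.symm c)) = algebraMap k K c := by
    intro c
    apply (algebraMap K L).injective
    rw [hθ, Subalgebra.coe_algebraMap, ← map_pow, ← hσ, RingEquiv.apply_symm_apply,
      ← IsScalarTower.algebraMap_apply]
  -- the subalgebra `T = θ(N)`
  obtain ⟨T, hT⟩ : ∃ T : Subalgebra k K, ∀ y : K, y ∈ T ↔ ∃ x : N, θ x = y :=
    ⟨{ toSubsemiring := θ.range.toSubsemiring
       algebraMap_mem' := fun c => ⟨algebraMap k N (σ.symm c), hθσ c⟩ }, fun y => Iff.rfl⟩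
  refine ⟨n, T, ?_, ?_, ?_⟩
  · -- `T ⊆ O`
    intro y hy
    obtain ⟨x, rfl⟩ := (hT y).mp (Subalgebra.mem_toSubring.mp hy)
    rw [ValuationSubring.mem_toSubring, ValuationSubring.mem_comap, hθ]
    exact pow_mem (hNO' x.2) _
  · -- `T` is smooth over `k`: `θ` is a ring isomorphism `N ≅ T` twisting the structure maps by `σ`
    let θT : N →+* T :=
      { toFun := fun x => ⟨θ x, (hT _).mpr ⟨x, rfl⟩⟩
        map_one' := Subtype.ext (map_one θ)
        map_mul' := fun x y => Subtype.ext (map_mul θ x y)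
        map_zero' := Subtype.ext (map_zero θ)
        map_add' := fun x y => Subtype.ext (map_add θ x y) }
    have hθT : Function.Bijective θT := by
      refine ⟨fun x y hxy => hθinj (congrArg Subtype.val hxy), fun y => ?_⟩
      obtain ⟨x, hx⟩ := (hT y).mp y.2
      exact ⟨x, Subtype.ext hx⟩
    refine smooth_of_ringEquiv_twist hNs σ.symm (RingEquiv.ofBijective θT hθT) ?_
    refine RingHom.ext fun c => Subtype.ext ?_
    exact (hθσ c).symm
  · -- `r ^ p ^ n = θ r ∈ T` for `r ∈ R`
    intro r hr
    refine (hT _).mpr ⟨⟨algebraMap K L r, hRN r hr⟩, ?_⟩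
    apply (algebraMap K L).injective
    rw [hθ, map_pow]

end Summit.ResolutionOfSingularities.ResolutionOfSingularities.Theorems.ValuativeSmoothing
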